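import Literature.NumberTheory.IwasawaTheory.FukudaGrowthAlgebra
import HarnessLib

/-!
# The DEPTH lemma at `p = 2`: a finite abelian `2`-group `M` with an automorphism `φ`, `φ^{2^t} = 1`, such that
# `#M/(1+φ)M ≤ 2` and `#M/(φ−1)M ≥ 4` has `#M/2M ≤ 2` (finite-level shadow of «`X = Λ/J`, `v₂(J(−2)) = 1`, `J(0) ⊆ 4ℤ₂` ⟹ `X/2X = 𝔽₂`»)

Topic `NumberTheory/IwasawaTheory` (namespace = path).  THEOREM-ONLY file (no definition, no named fact, no instance, no `sorry`), written by the
prover seat `bsd-line-att-p3` g42 (cell `bsd-f1-sign2`, route `AlignedTransportAtTwo`; `--supports` stmt-BirchSwinnertonDyer-22298, closes nothing).  It is the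
algebra brick of the «depth door» `ClassGroupPRankLeOneOfAmbiguousLayerTwo.lean` (this seat): in Fukuda's finite package `A = Gal(H_2(K_{n+2})/K_{n+2})`
with `φ` = conjugation by a totally ramified inertia generator, `#A/(1+φ)A = 2^{e_{n+1}}` (Washington Lemma 13.18 over a layer with `2 ∤ h(K_n)`, where
`Y₀ = A`) and `#A/(φ−1)A = #A^φ = #Cl(K_{n+2})[2^∞]^{Gal(K_{n+2}/K_n)}` (Chevalley's ambiguous classes), while `#A/2A = 2^{rank₂ Cl(K_{n+2})}`.

THE LEMMA (`card_quotient_map_two_le_two`).  `M` a finite abelian group of `2`-power order, `φ ∈ End_ℤ(M)` with `φ^{2^t} = 1`.  If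
`#(M/(1+φ)M) ≤ 2` and `#(M/(φ−1)M) ≥ 4` then `#(M/2M) ≤ 2`.

PROOF.  Write `S = (1+φ)M`, `D = (φ−1)M`, `P = 2M`.  (a) `P ⊆ S` (`M/S` has order `≤ 2`), so `D ⊆ S` (`(φ−1)x = (1+φ)x − 2x`).  (b) The
coinvariant quotient `C = M/D` has order `≥ 4` and `#(C/2C) ≤ #(M/S) ≤ 2` (`2·x̄ = \overline{(1+φ)x}`); a finite abelian `2`-group with these two
properties has `C[2] ⊆ 2C` (`#C[2] = #(C/2C) ≤ 2` while `2C ≠ 0` contains an element of order `2`).  (c) For `x ∈ M` write `(φ−1)x = (1+φ)y = 2y + (φ−1)y`;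
then `2ȳ = 0` in `C`, so `y ∈ 2M + D` and `(φ−1)x ∈ 2M + (φ−1)²M`: **`D ⊆ P + (φ−1)²M`**.  (d) Iterating, `D ⊆ P + (φ−1)^{k}M` for every `k ≥ 1`, and
`(φ−1)^{2^t}M ⊆ 2M` (`(X+1)^{2^t} ≡ X^{2^t} + 1 (mod 2)`, tree `FukudaNakayama.exists_X_add_one_pow_prime_pow_eq`); hence `D ⊆ P`, `S ⊆ D + P = P` and
`#(M/P) ≤ #(M/S) ≤ 2`.

In Iwasawa-algebra terms (`X = Λ/J` cyclic, `Λ = ℤ₂⟦T⟧`): `#X/(2+T)X = 2` says `v₂(j(−2)) = 1` for some `j ∈ J`, `#X/TX ≥ 4` says `J(0) ⊆ 4ℤ₂`; together the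
linear coefficient of `j` is odd, `j ≡ T·(unit) (mod 2)`, and `X/2X = 𝔽₂⟦T⟧/(T)`.  At odd `p` the analogous statement is empty (door L10 with `j = 1` already reads
`rank_p Cl(K_{n+1}) ≤ p − 2`); at `p = 2` it is the first criterion that uses Chevalley's count for the cyclic QUARTIC layer `K_{n+2}/K_n` rather than a unit of
`K_{n+1}`.  Not found in print in this form (corpus hybrid/vsearch: Lang Ch. 13 §4, Washington §13.3; galaxy: noise); ingredients cited at each use (D-0014).

References: [Washington1997] L. Washington, *Introduction to Cyclotomic Fields*, 2nd ed., §13.3 Lemmas 13.15, 13.18, Prop. 13.22; [Fukuda1994] T. Fukuda,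
*Remarks on ℤ_p-extensions of number fields*, Proc. Japan Acad. 70 A (1994), Thm. 1, p. 264; [Lang1990] S. Lang, *Cyclotomic Fields I and II*, Ch. 5 §1,
Ch. 13 §4.
-/

set_option autoImplicit false

noncomputable section

open Finset Polynomial

namespace Literature.NumberTheory.IwasawaTheory.FukudaDepth

open Literature.NumberTheory.IwasawaTheory.FukudaNakayama

/-! ## §1 Generic pieces of finite abelian group algebra -/

section Generic

variable {M : Type*} [AddCommGroup M]

/-- `#(X/f(X)) = #ker f` for an endomorphism `f` of a finite abelian group (`X/ker f ≅ f(X)`). [folklore] -/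
private theorem card_quotient_range_eq_card_ker [Finite M] (f : Module.End ℤ M) :
    Nat.card (M ⧸ LinearMap.range f) = Nat.card (LinearMap.ker f) := by
  have h1 : Nat.card (LinearMap.ker f) * Nat.card (LinearMap.range f) = Nat.card M := by
    rw [← Nat.card_congr (LinearMap.quotKerEquivRange f).toEquiv]
    exact (Submodule.card_eq_card_quotient_mul_card (LinearMap.ker f)).symm
  have h2 : Nat.card (LinearMap.range f) * Nat.card (M ⧸ LinearMap.range f) = Nat.card M :=
    (Submodule.card_eq_card_quotient_mul_card (LinearMap.range f)).symm
  have hpos : 0 < Nat.card (LinearMap.range f) := Nat.card_pos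
  apply Nat.eq_of_mul_eq_mul_left hpos
  rw [h2, ← h1, mul_comm]

/-- A larger subgroup has a smaller quotient. [folklore] -/
private theorem card_quotient_le_of_le [Finite M] {S R : Submodule ℤ M} (h : S ≤ R) :
    Nat.card (M ⧸ R) ≤ Nat.card (M ⧸ S) := by
  haveI : Finite (M ⧸ S) := Finite.of_surjective _ (Submodule.Quotient.mk_surjective S)
  exact Nat.card_le_card_of_surjective (Submodule.mapQ S R LinearMap.id h) (by
    rintro ⟨x⟩
    exact ⟨Submodule.Quotient.mk x, rfl⟩)

/-- If `M/S` has at most two elements then `2x ∈ S` for every `x`. [folklore] -/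
private theorem two_smul_mem_of_card_quotient_le_two [Finite M] (S : Submodule ℤ M) (h : Nat.card (M ⧸ S) ≤ 2) (x : M) :
    (2 : ℤ) • x ∈ S := by
  haveI : Finite (M ⧸ S) := Finite.of_surjective _ (Submodule.Quotient.mk_surjective S)
  have hpos : 0 < Nat.card (M ⧸ S) := Nat.card_pos
  have hkill : (Nat.card (M ⧸ S)) • (S.mkQ x) = 0 := card_nsmul_eq_zero'
  have h2 : (2 : ℕ) • (S.mkQ x) = 0 := by
    interval_cases (Nat.card (M ⧸ S))
    · rw [one_smul] at hkill
      rw [hkill]; exact smul_zero _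
    · exact hkill
  rw [← Submodule.ker_mkQ S, LinearMap.mem_ker, map_zsmul, two_smul]
  rwa [two_nsmul] at h2

/-- The image of a submodule is stable: `f(P) ⊆ P` for `P = 2M` (indeed for `P = mM`). [folklore] -/
private theorem map_le_map_top_smul (f : Module.End ℤ M) (m : ℤ) :
    ((⊤ : Submodule ℤ M).map (m • (1 : Module.End ℤ M))).map f ≤ (⊤ : Submodule ℤ M).map (m • (1 : Module.End ℤ M)) := by
  rintro _ ⟨_, ⟨x, -, rfl⟩, rfl⟩
  refine ⟨f x, Submodule.mem_top, ?_⟩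
  simp only [LinearMap.smul_apply, Module.End.one_apply, map_zsmul]

/-- **`(φ − 1)^{2^t} M ⊆ 2M` when `φ^{2^t} = 1`** (`(X+1)^{2^t} = X^{2^t} + 1 + 2R(X)` in `ℤ[X]`, evaluated at `X = φ − 1`).
[cite: Washington1997, §13.3 Prop. 13.22 (proof: `γ` acts unipotently mod `p`)] -/
theorem sub_one_pow_two_pow_apply_mem (φ : Module.End ℤ M) {t : ℕ} (hφ : φ ^ 2 ^ t = 1) (x : M) :
    ((φ - 1) ^ 2 ^ t : Module.End ℤ M) x ∈ (⊤ : Submodule ℤ M).map ((2 : ℤ) • (1 : Module.End ℤ M)) := by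
  haveI : Fact (Nat.Prime 2) := ⟨Nat.prime_two⟩
  obtain ⟨R, hR⟩ := exists_X_add_one_pow_prime_pow_eq 2 t
  have h := congrArg (aeval (φ - 1)) hR
  rw [map_pow, map_add, aeval_X, map_one, sub_add_cancel, hφ, map_add, map_add, map_pow, aeval_X, map_one, map_mul,
    aeval_C, algebraMap_int_eq, eq_intCast] at h
  -- `(φ-1)^{2^t} + 2 R(φ-1) = 0`
  have h3 : (φ - 1) ^ 2 ^ t + (((2 : ℕ) : ℤ) : Module.End ℤ M) * aeval (φ - 1) R = 0 := by
    have h' : (φ - 1) ^ 2 ^ t + 1 + (((2 : ℕ) : ℤ) : Module.End ℤ M) * aeval (φ - 1) R - 1 = 0 := by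
      rw [← h, sub_self]
    rw [← h']; abel
  have h4 : ((φ - 1) ^ 2 ^ t : Module.End ℤ M) x = -((((2 : ℕ) : ℤ) : Module.End ℤ M) (aeval (φ - 1) R x)) := by
    rw [eq_neg_of_add_eq_zero_left h3, LinearMap.neg_apply, Module.End.mul_apply]
  rw [h4, Module.End.intCast_apply]
  refine ⟨-(aeval (φ - 1) R x), Submodule.mem_top, ?_⟩
  rw [LinearMap.smul_apply, Module.End.one_apply, smul_neg, Nat.cast_ofNat]

end Generic

/-! ## §2 A finite abelian `2`-group `C` with `#C ≥ 4` and `#(C/2C) ≤ 2` has `C[2] ⊆ 2C` -/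

section Torsion

variable {C : Type*} [AddCommGroup C] [Finite C]

/-- **`C[2] ⊆ 2C`** for a finite abelian group `C` of `2`-power order with `#C ≥ 4` and `#(C/2C) ≤ 2`: `#C[2] = #(C/2C) ≤ 2`, while `2C` (of order
`#C/#C[2] ≥ 2`, a `2`-group) contains an element `z` of order `2` (Cauchy); so `C[2] = {0, z} ⊆ 2C`.  (Equivalently: `C` is cyclic of order `≥ 4`.)
[cite: Lang1990, Ch. 5 §1 (finite `ℤ_p`-modules)] -/
theorem mem_range_two_smul_of_two_smul_eq_zero (hC : ∃ a : ℕ, Nat.card C = 2 ^ a)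
    (h2 : Nat.card (C ⧸ LinearMap.range ((2 : ℤ) • (1 : Module.End ℤ C))) ≤ 2) (h4 : 4 ≤ Nat.card C)
    {y : C} (hy : (2 : ℤ) • y = 0) : y ∈ LinearMap.range ((2 : ℤ) • (1 : Module.End ℤ C)) := by
  classical
  haveI : Fact (Nat.Prime 2) := ⟨Nat.prime_two⟩
  set π : Module.End ℤ C := (2 : ℤ) • 1 with hπ
  have hπapp : ∀ x : C, π x = (2 : ℤ) • x := fun x => rfl
  -- `#ker π ≤ 2`
  have hker : Nat.card (LinearMap.ker π) ≤ 2 := by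
    rw [← card_quotient_range_eq_card_ker π]; exact h2
  -- `#range π ≥ 2`, a power of `2`
  obtain ⟨a, ha⟩ := hC
  have hmul := Submodule.card_eq_card_quotient_mul_card (LinearMap.range π)
  have hrange2 : 2 ∣ Nat.card (LinearMap.range π) := by
    have hdvd : Nat.card (LinearMap.range π) ∣ 2 ^ a := by
      rw [← ha]; exact Dvd.intro _ hmul.symm
    obtain ⟨b, -, hb⟩ := (Nat.dvd_prime_pow Nat.prime_two).mp hdvd
    rcases b with _ | b
    · -- `#range = 1` forces `#C ≤ 2`
      exfalso
      rw [pow_zero] at hb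
      rw [hb, one_mul] at hmul
      omega
    · rw [hb, pow_succ]; exact Dvd.intro_left _ rfl
  -- Cauchy: an element `z ∈ range π` of order `2`
  obtain ⟨z, hz⟩ := exists_prime_addOrderOf_dvd_card' (G := LinearMap.range π) 2 hrange2
  have hz0 : (z : C) ≠ 0 := by
    intro h
    have : z = 0 := Subtype.ext h
    rw [this, addOrderOf_zero] at hz
    exact absurd hz (by norm_num)
  have hz2 : (2 : ℤ) • (z : C) = 0 := by
    have h1 : (addOrderOf z) • z = 0 := addOrderOf_nsmul_eq_zero z
    rw [hz] at h1
    have h2' : ((2 : ℕ) • z : LinearMap.range π) = 0 := h1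
    have h3 : (2 : ℕ) • (z : C) = 0 := by exact_mod_cast congrArg Subtype.val h2'
    exact_mod_cast h3
  -- `ker π = ℤ z`
  have hzker : (z : C) ∈ LinearMap.ker π := by rw [LinearMap.mem_ker, hπapp]; exact hz2
  have hyker : y ∈ LinearMap.ker π := by rw [LinearMap.mem_ker, hπapp]; exact hy
  set Z : Submodule ℤ C := Submodule.span ℤ {(z : C)} with hZ
  have hZle : Z ≤ LinearMap.ker π := by
    rw [hZ, Submodule.span_le, Set.singleton_subset_iff]; exact hzker
  have hcardZ : 2 ≤ Nat.card Z := by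
    -- `0` and `z` are two distinct elements of `Z`
    have h0 : (0 : C) ∈ Z := Z.zero_mem
    have h1 : (z : C) ∈ Z := Submodule.subset_span rfl
    let f : Fin 2 → Z := fun i => if i = 0 then ⟨0, h0⟩ else ⟨z, h1⟩
    have hf : Function.Injective f := by
      intro i j hij
      fin_cases i <;> fin_cases j
      · rfl
      · exfalso; simp only [f] at hij; exact hz0 (congrArg Subtype.val hij).symm
      · exfalso; simp only [f] at hij; exact hz0 (congrArg Subtype.val hij)
      · rfl
    have := Nat.card_le_card_of_injective f hf
    simpa using this
  have hZeq : Z = LinearMap.ker π := by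
    apply le_antisymm hZle
    -- equal cardinalities
    have hle : Nat.card (LinearMap.ker π) ≤ Nat.card Z := hker.trans hcardZ
    have hinj : Function.Injective (Submodule.inclusion hZle) := Submodule.inclusion_injective hZle
    have hbij : Function.Bijective (Submodule.inclusion hZle) := by
      rw [Nat.bijective_iff_injective_and_card]
      exact ⟨hinj, le_antisymm (Nat.card_le_card_of_injective _ hinj) hle⟩
    intro x hx
    obtain ⟨w, hw⟩ := hbij.2 ⟨x, hx⟩
    have : (w : C) = x := congrArg Subtype.val hw
    rw [← this]; exact w.2
  -- conclude
  have hyZ : y ∈ Z := by rw [hZeq]; exact hyker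
  rw [hZ, Submodule.mem_span_singleton] at hyZ
  obtain ⟨k, rfl⟩ := hyZ
  exact Submodule.smul_mem _ k z.2

end Torsion

/-! ## §3 The depth lemma -/

section Depth

variable {M : Type*} [AddCommGroup M] [Finite M]

/-- **The relative form of §2 in `M`**: with `D = (φ−1)M`, `P = 2M`, `S = (1+φ)M`, if `#(M/D) ≥ 4` and `#(M/S) ≤ 2` then every `y` with `2y ∈ D` lies
in `P + D` (apply §2 to the coinvariant quotient `C = M/D`, where `2C` is the image of `S`). [cite: Washington1997, §13.3 Lemma 13.18] -/
theorem mem_sup_of_two_smul_mem (hM : ∃ a : ℕ, Nat.card M = 2 ^ a) (φ : Module.End ℤ M)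
    (h1 : Nat.card (M ⧸ (⊤ : Submodule ℤ M).map (1 + φ)) ≤ 2)
    (h2 : 4 ≤ Nat.card (M ⧸ (⊤ : Submodule ℤ M).map (φ - 1)))
    {y : M} (hy : (2 : ℤ) • y ∈ (⊤ : Submodule ℤ M).map (φ - 1)) :
    y ∈ (⊤ : Submodule ℤ M).map ((2 : ℤ) • (1 : Module.End ℤ M)) ⊔ (⊤ : Submodule ℤ M).map (φ - 1) := by
  classical
  set D : Submodule ℤ M := (⊤ : Submodule ℤ M).map (φ - 1) with hD
  set S : Submodule ℤ M := (⊤ : Submodule ℤ M).map (1 + φ) with hS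
  set πC : Module.End ℤ (M ⧸ D) := (2 : ℤ) • 1 with hπC
  have hπCapp : ∀ c : M ⧸ D, πC c = (2 : ℤ) • c := fun c => rfl
  haveI : Finite (M ⧸ D) := Finite.of_surjective _ (Submodule.Quotient.mk_surjective D)
  haveI : Finite (M ⧸ S) := Finite.of_surjective _ (Submodule.Quotient.mk_surjective S)
  haveI : Finite ((M ⧸ D) ⧸ S.map D.mkQ) := Finite.of_surjective _ (Submodule.Quotient.mk_surjective _)
  -- `C = M/D` has `2`-power order
  have hC : ∃ b : ℕ, Nat.card (M ⧸ D) = 2 ^ b := by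
    obtain ⟨a, ha⟩ := hM
    have hdvd : Nat.card (M ⧸ D) ∣ 2 ^ a := by
      rw [← ha]; exact Dvd.intro_left _ (Submodule.card_eq_card_quotient_mul_card D).symm
    obtain ⟨b, -, hb⟩ := (Nat.dvd_prime_pow Nat.prime_two).mp hdvd
    exact ⟨b, hb⟩
  -- `range πC = S.map mkQ`, so `#(C/2C) ≤ #(M/S) ≤ 2`
  have hrange : S.map D.mkQ ≤ LinearMap.range πC := by
    rintro _ ⟨_, ⟨x, -, rfl⟩, rfl⟩
    refine ⟨D.mkQ x, ?_⟩
    rw [hπCapp, ← map_zsmul, LinearMap.add_apply, Module.End.one_apply]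
    -- `2x - (1+φ)x = -(φ-1)x ∈ D`
    rw [← sub_eq_zero, ← map_sub, Submodule.mkQ_apply, Submodule.Quotient.mk_eq_zero]
    have : (2 : ℤ) • x - (x + φ x) = -((φ - 1) x) := by
      rw [LinearMap.sub_apply, Module.End.one_apply, two_smul]; abel
    rw [this]
    exact D.neg_mem ⟨x, Submodule.mem_top, rfl⟩
  have h2C : Nat.card ((M ⧸ D) ⧸ LinearMap.range πC) ≤ 2 := by
    refine (card_quotient_le_of_le hrange).trans ?_
    refine (Nat.card_le_card_of_surjective (Submodule.mapQ S (S.map D.mkQ) D.mkQ (Submodule.le_comap_map _ _)) ?_).trans h1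
    rintro ⟨⟨x⟩⟩
    exact ⟨Submodule.Quotient.mk x, rfl⟩
  -- apply §2 to `ȳ`
  have hy' : (2 : ℤ) • D.mkQ y = 0 := by
    rw [← map_zsmul, Submodule.mkQ_apply, Submodule.Quotient.mk_eq_zero]; exact hy
  obtain ⟨c, hc⟩ := mem_range_two_smul_of_two_smul_eq_zero hC h2C h2 hy'
  obtain ⟨z, rfl⟩ := D.mkQ_surjective c
  rw [hπCapp, ← map_zsmul, ← sub_eq_zero, ← map_sub, Submodule.mkQ_apply, Submodule.Quotient.mk_eq_zero] at hc
  -- `y = 2z + (y - 2z)` hmm: `2z - y ∈ D`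
  have : y = (2 : ℤ) • z + (-( (2 : ℤ) • z - y)) := by abel
  rw [this]
  exact Submodule.add_mem_sup ⟨z, Submodule.mem_top, by rw [LinearMap.smul_apply, Module.End.one_apply]⟩ (D.neg_mem hc)

/-- ★★ **THE DEPTH LEMMA (`p = 2`).**  `M` a finite abelian group of `2`-power order, `φ ∈ End_ℤ(M)` with `φ^{2^t} = 1`,
`#(M/(1+φ)M) ≤ 2` and `#(M/(φ−1)M) ≥ 4`.  Then **`#(M/2M) ≤ 2`** (`rank₂ M ≤ 1`).  In Fukuda's package over a layer `K_n` with `2 ∤ h(K_n)`: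
`2^{e_{n+1}} ≤ 2` and `#A^{φ} ≥ 4` force `rank₂ Cl(K_{n+2}) ≤ 1`. [cite: Washington1997, §13.3 Lemmas 13.15, 13.18 and Prop. 13.22]
[cite: Fukuda1994, Thm. 1 (proof, p. 264)] -/
theorem card_quotient_map_two_le_two (hM : ∃ a : ℕ, Nat.card M = 2 ^ a) (φ : Module.End ℤ M) {t : ℕ} (hφ : φ ^ 2 ^ t = 1)
    (h1 : Nat.card (M ⧸ (⊤ : Submodule ℤ M).map (1 + φ)) ≤ 2)
    (h2 : 4 ≤ Nat.card (M ⧸ (⊤ : Submodule ℤ M).map (φ - 1))) :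
    Nat.card (M ⧸ (⊤ : Submodule ℤ M).map ((2 : ℤ) • (1 : Module.End ℤ M))) ≤ 2 := by
  classical
  set D : Submodule ℤ M := (⊤ : Submodule ℤ M).map (φ - 1) with hD
  set S : Submodule ℤ M := (⊤ : Submodule ℤ M).map (1 + φ) with hS
  set P : Submodule ℤ M := (⊤ : Submodule ℤ M).map ((2 : ℤ) • (1 : Module.End ℤ M)) with hP
  have hPmem : ∀ x : M, (2 : ℤ) • x ∈ P := fun x =>
    ⟨x, Submodule.mem_top, by rw [LinearMap.smul_apply, Module.End.one_apply]⟩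
  -- (a) `P ⊆ S`, hence `(φ-1)x ∈ S`
  have hPS : P ≤ S := by
    rintro _ ⟨x, -, rfl⟩
    rw [LinearMap.smul_apply, Module.End.one_apply]
    exact two_smul_mem_of_card_quotient_le_two S h1 x
  have hDS : ∀ x : M, (φ - 1) x ∈ S := by
    intro x
    have : (φ - 1) x = (1 + φ) x - (2 : ℤ) • x := by
      rw [LinearMap.sub_apply, LinearMap.add_apply, Module.End.one_apply, two_smul]; abel
    rw [this]
    exact S.sub_mem ⟨x, Submodule.mem_top, rfl⟩ (hPS (hPmem x))
  -- (c) `D ⊆ P + (φ-1)²M`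
  have hstep : D ≤ P ⊔ (⊤ : Submodule ℤ M).map ((φ - 1) ^ 2) := by
    rintro _ ⟨x, -, rfl⟩
    obtain ⟨y, -, hy⟩ := hDS x
    -- `(φ-1)x = (1+φ)y = 2y + (φ-1)y`, so `2y = (φ-1)(x-y) ∈ D`
    have h2y : (2 : ℤ) • y ∈ D := by
      refine ⟨x - y, Submodule.mem_top, ?_⟩
      have : (φ - 1) (x - y) = (φ - 1) x - (φ - 1) y := map_sub _ _ _
      rw [this, ← hy, LinearMap.add_apply, LinearMap.sub_apply, Module.End.one_apply, two_smul]
      abel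
    obtain ⟨u, hu, v, hv, huv⟩ := Submodule.mem_sup.mp (mem_sup_of_two_smul_mem hM φ h1 h2 h2y)
    obtain ⟨w, -, rfl⟩ := hv
    -- `(φ-1)x = (1+φ)y = (1+φ)u + (1+φ)(φ-1)w` with `u ∈ P`
    rw [← hy, ← huv, map_add]
    refine Submodule.add_mem _ ?_ ?_
    · -- `(1+φ)u ∈ P`
      obtain ⟨u', -, rfl⟩ := hu
      refine Submodule.mem_sup_left ⟨(1 + φ) u', Submodule.mem_top, ?_⟩
      simp only [LinearMap.smul_apply, Module.End.one_apply, map_zsmul]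
    · -- `(1+φ)(φ-1)w = 2(φ-1)w + (φ-1)²w`
      have : (1 + φ) ((φ - 1) w) = (2 : ℤ) • ((φ - 1) w) + ((φ - 1) ^ 2 : Module.End ℤ M) w := by
        rw [pow_two, Module.End.mul_apply, LinearMap.add_apply, Module.End.one_apply, LinearMap.sub_apply (φ) 1 ((φ - 1) w),
          Module.End.one_apply, two_smul]
        abel
      rw [this]
      refine Submodule.add_mem_sup (hPmem _) ?_
      exact ⟨w, Submodule.mem_top, rfl⟩
  -- (d) iterate: `D ⊆ P + (φ-1)^{k+1} M` for all `k`
  have hiter : ∀ k : ℕ, D ≤ P ⊔ (⊤ : Submodule ℤ M).map ((φ - 1) ^ (k + 1)) := by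
    intro k
    induction k with
    | zero => rw [zero_add, pow_one]; exact le_sup_right
    | succ k ih =>
      -- `(φ-1)^{k+2} M = (φ-1)^{k+1} D`... use `D ⊆ P + (φ-1)²M` pushed through `(φ-1)^k`
      have hk : (⊤ : Submodule ℤ M).map ((φ - 1) ^ (k + 1)) = D.map ((φ - 1) ^ k) := by
        rw [hD, ← Submodule.map_comp, ← Module.End.mul_eq_comp, ← pow_succ]
      refine ih.trans (sup_le le_sup_left ?_)
      rw [hk]
      refine (Submodule.map_mono hstep).trans ?_
      rw [Submodule.map_sup]
      refine sup_le ((map_le_map_top_smul _ 2).trans le_sup_left) ?_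
      rw [← Submodule.map_comp, ← Module.End.mul_eq_comp, ← pow_add, show k + 1 + 1 = k + 2 from rfl]
      exact le_sup_right
  -- `(φ-1)^{2^t} M ⊆ P`
  have htop : (⊤ : Submodule ℤ M).map ((φ - 1) ^ 2 ^ t : Module.End ℤ M) ≤ P := by
    rintro _ ⟨x, -, rfl⟩; exact sub_one_pow_two_pow_apply_mem φ hφ x
  have hDP : D ≤ P := by
    have h := hiter (2 ^ t - 1)
    rw [Nat.sub_add_cancel (Nat.one_le_two_pow)] at h
    exact h.trans (sup_le le_rfl htop)
  -- `S ⊆ P`, so `#(M/P) ≤ #(M/S) ≤ 2`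
  have hSP : S ≤ P := by
    rintro _ ⟨x, -, rfl⟩
    have : (1 + φ) x = (2 : ℤ) • x + (φ - 1) x := by
      rw [LinearMap.add_apply, LinearMap.sub_apply, Module.End.one_apply, two_smul]; abel
    rw [this]
    exact P.add_mem (hPmem x) (hDP ⟨x, Submodule.mem_top, rfl⟩)
  exact (card_quotient_le_of_le hSP).trans h1

/-- The depth lemma with the second hypothesis in FIXED-POINT currency: `#ker(φ − 1) ≥ 4` (for a finite `M`, `#M/(φ−1)M = #M^{φ}`).
[cite: Washington1997, §13.3 Lemma 13.18 and Prop. 13.22] [cite: Lang1990, Ch. 13 §4 Lemma 4.1] -/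
theorem card_quotient_map_two_le_two_of_ker (hM : ∃ a : ℕ, Nat.card M = 2 ^ a) (φ : Module.End ℤ M) {t : ℕ} (hφ : φ ^ 2 ^ t = 1)
    (h1 : Nat.card (M ⧸ (⊤ : Submodule ℤ M).map (1 + φ)) ≤ 2)
    (h2 : 4 ≤ Nat.card (LinearMap.ker (φ - 1))) :
    Nat.card (M ⧸ (⊤ : Submodule ℤ M).map ((2 : ℤ) • (1 : Module.End ℤ M))) ≤ 2 := by
  refine card_quotient_map_two_le_two hM φ hφ h1 ?_
  rwa [Submodule.map_top, card_quotient_range_eq_card_ker]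

end Depth

end Literature.NumberTheory.IwasawaTheory.FukudaDepth

end
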